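import Summits.Ventures.HSemireg.WedgeHankelRecurrenceGaussChebyshevHalfAngleRootsReal

/-!
# Venture HSemireg — **THE REAL ROOT MULTISETS OF THE LEVEL SETS `C_n = ±2` (WITH MULTIPLICITIES): `(C_{2k+1} − 2).roots = {2} + 2·{2cos(2jπ∕(2k+1)) : 1 ≤ j ≤ k}`,
# `(C_{2k+1} + 2).roots = {−2} + 2·{2cos((2j+1)π∕(2k+1)) : j < k}`, `(C_{2k+2} − 2).roots = {2, −2} + 2·{2cos(jπ∕(k+1)) : 1 ≤ j ≤ k}`, `(C_{2k} + 2).roots = 2·{2cos((2j+1)π∕2k) : j < k}`** —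
# every interior extremal point `C_n = ±2` is a DOUBLE root, the endpoints `±2` are simple; hence `C_n ∓ 2` split over `ℝ` (`card roots = n`)

HONEST FRAMING. Part of the Lean index of the computation cell `pub-hsemireg` (seat p10 gen 49, Sunday typer «UNIFORM-IN-n»).  Real polynomial algebra and trigonometry only (Mathlib
`Polynomial.Chebyshev.S ∕ C`, `Polynomial.roots`, `Real.cos`); no variety, no cohomology theory, no sheaf, no Ext group and no semiregularity map is constructed here; nothing here says that
HC / HC_CM / HC_AV holds; no Literature fact (unproved `Prop`) is declared or used.  Custodian versions as in `WedgeHankelSiegelIdeal` (1/3).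
SOURCES (cited).  T. J. Rivlin, *The Chebyshev Polynomials* (1974), §1.2 (extrema `T_n(x) = ±1` at `cos(jπ∕n)`) and §2.7 Ex. 2.7.2; P. Ribenboim, *My Numbers, My Friends* (2000), Ch. 1 §IV ((IV.4)–(IV.6):
`V_{2k} ∓ 2`, `V_{2k+1} ∓ 2` as squares up to the factors `P ∓ 2`, `P² − 4`); É. Lucas, Amer. J. Math. 1 (1878) §IX.
PROOF TYPED HERE.  Rewrite with the monic half-angle identities of N485 (`C_{2k+1} − 2 = (X − 2)(S_k + S_{k−1})²`, `C_{2k+1} + 2 = (X + 2)(S_k − S_{k−1})²`, `C_{2k} − 2 = (X² − 4)S_{k−1}²`,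
`C_{2k} + 2 = C_k²`), then Mathlib `roots_mul ∕ roots_pow ∕ roots_X_sub_C` and the simple-root multisets of N500 (`S_k`, `C_k`) and N501 (`S_k ± S_{k−1}`).
DEDUP DISCLOSURE (`rg -n 'sub_two_roots|add_two_roots|LevelSet' Summits/Ventures/HSemireg`, `lean search`, 2026-09-04): Mathlib has the root SETS `eval_T_real_eq_one_iff ∕ _eq_neg_one_iff`
(no multiplicities) for `T`; nothing for `C`; the multisets below are not in the tree; 0 hits for the 6 names below.

WHAT IS IN THE TREE.  N485 (identities), N500 `chebyshevS_roots_real ∕ chebyshevC_roots_real`, N501 `chebyshevS_add_pred_roots_real ∕ chebyshevS_sub_pred_roots_real`.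
THIS FILE (namespace `Summit.Ventures.HSemireg.Wedge.HankelOuter` continued; CHAINED on N501; 0 definitions):
* §1267 **`chebyshevC_odd_sub_two_roots_real`**, **`chebyshevC_odd_add_two_roots_real`**, **`chebyshevC_even_sub_two_roots_real`**, **`chebyshevC_even_add_two_roots_real`**,
  `chebyshevC_sub_two_roots_card_real`, `chebyshevC_add_two_roots_card_real` (`C_n ∓ 2` split over `ℝ`, `n ≥ 1`).
CAVEATS.  Indices `2k+1`, `2k+2` (resp. `2k`) with `k ∈ ℕ`; `C_0 − 2 = 0` is excluded by the indexing.  Nothing Ext-side.  New names only.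
-/

open Module Polynomial Real
open scoped Matrix Polynomial

namespace Summit.Ventures.HSemireg.Wedge.HankelOuter

/-! ## §1267. Real root multisets of `C_n ∓ 2` -/

/-- **`(C_{2k+1} − 2).roots = {2} + 2·{2cos(2(j+1)π∕(2k+1)) : j < k}` over `ℝ`** (the `k` interior points are double roots, `2` is simple). [Ribenboim (IV.6); Rivlin §1.2; this file, §1267] -/
theorem chebyshevC_odd_sub_two_roots_real (k : ℕ) :
    (Polynomial.Chebyshev.C ℝ (2 * (k : ℤ) + 1) - 2).roots = {2} + 2 • (Multiset.range k).map fun j : ℕ => 2 * cos (2 * (j + 1) * π / (2 * k + 1)) := by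
  have hW := (chebyshevS_add_pred_natDegree_monic (R := ℝ) k).2
  have hX2 : (Polynomial.X - 2 : ℝ[X]) = Polynomial.X - Polynomial.C 2 := by rw [Polynomial.C_ofNat]
  have hne : (Polynomial.X - 2 : ℝ[X]) * (Polynomial.Chebyshev.S ℝ (k : ℤ) + Polynomial.Chebyshev.S ℝ ((k : ℤ) - 1)) ^ 2 ≠ 0 := by
    rw [hX2]; exact ((monic_X_sub_C 2).mul (hW.pow 2)).ne_zero
  rw [chebyshevC_two_mul_add_one_sub_two, roots_mul hne, hX2, roots_X_sub_C, roots_pow, chebyshevS_add_pred_roots_real]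

/-- **`(C_{2k+1} + 2).roots = {−2} + 2·{2cos((2j+1)π∕(2k+1)) : j < k}` over `ℝ`** (interior points double, `−2` simple). [Ribenboim (IV.6); Rivlin §1.2; this file, §1267] -/
theorem chebyshevC_odd_add_two_roots_real (k : ℕ) :
    (Polynomial.Chebyshev.C ℝ (2 * (k : ℤ) + 1) + 2).roots = {-2} + 2 • (Multiset.range k).map fun j : ℕ => 2 * cos ((2 * j + 1) * π / (2 * k + 1)) := by
  have hW := (chebyshevS_sub_pred_natDegree_monic (R := ℝ) k).2
  have hX2 : (Polynomial.X + 2 : ℝ[X]) = Polynomial.X - Polynomial.C (-2) := by rw [map_neg, sub_neg_eq_add, Polynomial.C_ofNat]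
  have hne : (Polynomial.X + 2 : ℝ[X]) * (Polynomial.Chebyshev.S ℝ (k : ℤ) - Polynomial.Chebyshev.S ℝ ((k : ℤ) - 1)) ^ 2 ≠ 0 := by
    rw [hX2]; exact ((monic_X_sub_C (-2)).mul (hW.pow 2)).ne_zero
  rw [chebyshevC_two_mul_add_one_add_two, roots_mul hne, hX2, roots_X_sub_C, roots_pow, chebyshevS_sub_pred_roots_real]

/-- **`(C_{2k+2} − 2).roots = {2, −2} + 2·{2cos((j+1)π∕(k+1)) : j < k}` over `ℝ`** (interior points double, `±2` simple). [Ribenboim (IV.5); Rivlin §1.2; this file, §1267] -/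
theorem chebyshevC_even_sub_two_roots_real (k : ℕ) :
    (Polynomial.Chebyshev.C ℝ (2 * ((k : ℤ) + 1)) - 2).roots = {2, -2} + 2 • (Multiset.range k).map fun j : ℕ => 2 * cos ((j + 1) * π / (k + 1)) := by
  have hS := (chebyshevS_natDegree_monic (R := ℝ) k).2
  have h4 : (Polynomial.X ^ 2 - 4 : ℝ[X]) = (Polynomial.X - Polynomial.C 2) * (Polynomial.X - Polynomial.C (-2)) := by
    simp only [map_neg, sub_neg_eq_add, Polynomial.C_ofNat]; ring
  have hne4 : (Polynomial.X - Polynomial.C 2 : ℝ[X]) * (Polynomial.X - Polynomial.C (-2)) ≠ 0 := ((monic_X_sub_C 2).mul (monic_X_sub_C (-2))).ne_zero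
  have hne : (Polynomial.X ^ 2 - 4 : ℝ[X]) * Polynomial.Chebyshev.S ℝ (k : ℤ) ^ 2 ≠ 0 := by
    rw [h4]; exact (((monic_X_sub_C 2).mul (monic_X_sub_C (-2))).mul (hS.pow 2)).ne_zero
  rw [chebyshevC_two_mul_sub_two, add_sub_cancel_right, roots_mul hne, h4, roots_mul hne4, roots_X_sub_C, roots_X_sub_C, roots_pow, chebyshevS_roots_real,
    Multiset.singleton_add, ← Multiset.insert_eq_cons]

/-- **`(C_{2k} + 2).roots = 2·{2cos((2j+1)π∕2k) : j < k}` over `ℝ`** (every root double; `C_{2k} + 2 = C_k²`). [Ribenboim (IV.4); Rivlin §1.2; this file, §1267] -/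
theorem chebyshevC_even_add_two_roots_real (k : ℕ) :
    (Polynomial.Chebyshev.C ℝ (2 * (k : ℤ)) + 2).roots = 2 • (Multiset.range k).map fun j : ℕ => 2 * cos ((2 * j + 1) * π / (2 * k)) := by
  rw [chebyshevC_two_mul_add_two, roots_pow, chebyshevC_roots_real]

/-- **`C_n − 2` splits over `ℝ`: `card (C_n − 2).roots = n`** (`n ≥ 1`; the roots are `2cos(2jπ∕n)`, `0 ≤ j < n`, listed with multiplicity). [Rivlin §1.2; this file, §1267] -/
theorem chebyshevC_sub_two_roots_card_real {n : ℕ} (hn : n ≠ 0) : Multiset.card (Polynomial.Chebyshev.C ℝ (n : ℤ) - 2).roots = n := by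
  obtain ⟨k, rfl | rfl⟩ := Nat.even_or_odd' n
  · obtain ⟨j, rfl⟩ := Nat.exists_eq_add_one_of_ne_zero (by rintro rfl; exact hn rfl : k ≠ 0)
    rw [show (((2 * (j + 1) : ℕ)) : ℤ) = 2 * ((j : ℤ) + 1) by push_cast; ring, chebyshevC_even_sub_two_roots_real, Multiset.card_add, Multiset.card_nsmul, Multiset.card_map,
      Multiset.card_range, Multiset.insert_eq_cons, Multiset.card_cons, Multiset.card_singleton]
    ring
  · rw [show (((2 * k + 1 : ℕ)) : ℤ) = 2 * (k : ℤ) + 1 by push_cast; ring, chebyshevC_odd_sub_two_roots_real, Multiset.card_add, Multiset.card_nsmul, Multiset.card_map, Multiset.card_range,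
      Multiset.card_singleton]
    ring

/-- **`C_n + 2` splits over `ℝ`: `card (C_n + 2).roots = n`** (the roots are `2cos((2j+1)π∕n)`, `0 ≤ j < n`, listed with multiplicity; `n = 0`: `C_0 + 2 = 4`, no roots). [Rivlin §1.2; this file, §1267] -/
theorem chebyshevC_add_two_roots_card_real (n : ℕ) : Multiset.card (Polynomial.Chebyshev.C ℝ (n : ℤ) + 2).roots = n := by
  obtain ⟨k, rfl | rfl⟩ := Nat.even_or_odd' n
  · rw [show (((2 * k : ℕ)) : ℤ) = 2 * (k : ℤ) by push_cast; ring, chebyshevC_even_add_two_roots_real, Multiset.card_nsmul, Multiset.card_map, Multiset.card_range]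
  · rw [show (((2 * k + 1 : ℕ)) : ℤ) = 2 * (k : ℤ) + 1 by push_cast; ring, chebyshevC_odd_add_two_roots_real, Multiset.card_add, Multiset.card_nsmul, Multiset.card_map, Multiset.card_range,
      Multiset.card_singleton]
    ring

end Summit.Ventures.HSemireg.Wedge.HankelOuter
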